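import Summits.ResolutionOfSingularities.ResolutionOfSingularities.Theorems.EquisingularLiftEquisingularLiftNatJunctionTransversalIdeal
import Literature.AlgebraicGeometry.Resolution.AffineBlowupAlgebra
import HarnessLib

/-!
# Junction lemma J1 (transversal type `A₁`), part 2: `Bl_X H` is the disjoint union of the two sheets

[OURS · L1 W4.5(b)] Helper for the research stub `stub_elnat_three` of the crux `EquisingularLiftNat`
(stmt-ResolutionOfSingularities-20038; route `EquisingularLift`, chain w45b, CRUX-PLAN v3 §1.6 «NO-DAMAGE
(J1)» / §4 `junction_transversal_A1_noDamage`). NOT a statement of any manuscript; AI-written kernel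
lemma of the cell `res-hironaka` (weaker than expert review). CRUX-PLAN v3 §1.6: «`Bl_X` is an
isomorphism on each sheet and SEPARATES them (`St S₁ = {a = 0}` in chart `σ = τw·a`, `St S₂ =
{τ = b = 0}` in chart `τw = σb`, disjoint) ⇒ `Bl_X H ≅ H^ν = Bl_Σ H` near `x`».

**The model** (as in part 1). `R` any commutative ring, `𝒪_H = R[σ,τ,w]/(στ)` (`σ, τ, w = X 0, X 1,
X 2`), `I = I_X · 𝒪_H = (σ̄, τ̄w̄)` the trace of the ideal of `X = Σ ∪ R` (part 1,
`span_inf_span_eq_transversal`). `Bl_X H = Bl_I(Spec 𝒪_H) = Proj 𝒪_H[It]` (tree `affineBlowup I`),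
with charts `D₊(σ̄t) = Spec 𝒪_H[I/σ̄]`, `D₊(τ̄w̄t) = Spec 𝒪_H[I/τ̄w̄]` (tree `reesChartEquiv`,
`affineBlowup.chartι`; Stacks 0804).

**Proved here:**
* `blowupAlgebra_eq_bot_of_mul_eq_zero`, `exists_ringEquiv_blowupAlgebra_of_eq_bot`,
  `exists_ringEquiv_away_of_blowupAlgebra_eq_bot`, `basicOpen_inf_basicOpen_eq_bot_of_mul_eq_zero`,
  `basicOpen_sup_basicOpen_eq_top_of_span_pair` — GENERAL (any commutative ring, `I = (a, b)`):
  the charts `D₊(at)`, `D₊(bt)` cover `Bl_I`; if `ab = 0` they are disjoint and `R[I/a] = R·1 ⊆ R[1/a]`,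
  so the chart ring `(R[It])_{(at)} ≅ R[I/a]` is `R` modulo its `a`-power torsion
  (`ker_algebraMap_away_eq`) — i.e. `Bl_{(a,b)}(Spec R) = V(a-torsion) ⊔ V(b-torsion)` whenever
  `ab = 0` (reusable for the other one-step traces of CRUX-PLAN v3 §1.5, e.g. `(σ, τ^m)`);
* `mem_map_span_tau_iff` / `mem_map_span_sigma_iff` — in `𝒪_H` the `σ̄`-power torsion is `(τ̄)` and
  the `τ̄w̄`-power torsion is `(σ̄)` (saturation of monomial ideals, part 1);
* `junction_transversal_chart_sigma` — **`𝒪_H[I/σ̄] ≅ R[σ,τ,w]/(τ) = 𝒪_{S₂}`** over `𝒪_H`: the chart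
  `D₊(σ̄t)` of `Bl_X H` IS the sheet `S₂` (so `St S₂ = Bl_X S₂ ≅ S₂`);
* `junction_transversal_chart_tauw` — **`𝒪_H[I/τ̄w̄] ≅ R[σ,τ,w]/(σ) = 𝒪_{S₁}`**: `D₊(τ̄w̄t)` IS `S₁`;
* `junction_transversal_charts_disjoint` — `D₊(σ̄t) ∩ D₊(τ̄w̄t) = ∅` (`σ̄t · τ̄w̄t = 0` in `𝒪_H[It]`):
  the sheets are SEPARATED;
* `junction_transversal_charts_cover` — `D₊(σ̄t) ∪ D₊(τ̄w̄t) = Bl_X H`.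
Together: `Bl_X H = S₂ ⊔ S₁ = H^ν` (the normalisation), regular; no damage at a single-sheet
transversal-`A₁` junction.

What is NOT here: the packaging of the four statements into one `Scheme` isomorphism
`affineBlowup I ≅ Spec 𝒪_{S₂} ⨿ Spec 𝒪_{S₁}` (routine glueing, left to the consumer); the ambient
`Bl_X 𝔸³ = {τw = σb} ∪ {σ = τwa}` and its conifold point (tree `BlowupRegularPairCharts.lean` gives the
charts of the regular pair `(σ, τw)` if needed).
References: The Stacks Project, Tags 052Q, 07Z3, 0804 [StacksProject]; folklore.
-/

-- single-problem summit: the doubled namespace component `ResolutionOfSingularities` is forced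
set_option linter.dupNamespace false

noncomputable section

open MvPolynomial

namespace Summit.ResolutionOfSingularities.ResolutionOfSingularities.Theorems.EquisingularLift.Junction

universe u

/-! ## Affine blowup algebra of `(a, b)` at `a` when `a b = 0` -/

section BlowupGeneral

open Literature.AlgebraicGeometry.Resolution

variable {R : Type u} [CommRing R]

/-- If `a b = 0` then `R[(a, b)/a] ⊆ R[1/a]` is just the image of `R`: the generator `b/a = ab/a²`
vanishes. [folklore] -/
theorem blowupAlgebra_eq_bot_of_mul_eq_zero {a b : R} (hab : a * b = 0) {I : Ideal R}
    (hI : I = Ideal.span {a, b}) : blowupAlgebra I a = ⊥ := by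
  refine le_antisymm (Algebra.adjoin_le ?_) bot_le
  rintro _ ⟨x, hx, rfl⟩
  rw [hI] at hx
  obtain ⟨α, β, rfl⟩ := Ideal.mem_span_pair.mp hx
  have hb : algebraMap R (Localization.Away a) b * IsLocalization.Away.invSelf a = 0 := by
    calc algebraMap R (Localization.Away a) b * IsLocalization.Away.invSelf a
        = algebraMap R _ b * (algebraMap R _ a * IsLocalization.Away.invSelf a) *
            IsLocalization.Away.invSelf a := by rw [IsLocalization.Away.mul_invSelf, mul_one]
      _ = algebraMap R _ (a * b) * IsLocalization.Away.invSelf a *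
            IsLocalization.Away.invSelf a := by rw [map_mul]; ring
      _ = 0 := by rw [hab, map_zero, zero_mul, zero_mul]
  have e : algebraMap R (Localization.Away a) (α * a + β * b) * IsLocalization.Away.invSelf a =
      algebraMap R _ α := by
    rw [map_add, map_mul, map_mul, add_mul, mul_assoc, IsLocalization.Away.mul_invSelf, mul_one,
      mul_assoc, hb, mul_zero, add_zero]
  rw [SetLike.mem_coe, e]
  exact Subalgebra.algebraMap_mem _ _

/-- If `R[I/a] = R · 1` then `R[I/a]` is `R` modulo the `a`-power torsion (the kernel of
`R → R[1/a]`), compatibly with the structure map. [folklore] -/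
theorem exists_ringEquiv_blowupAlgebra_of_eq_bot {I : Ideal R} (a : R)
    (h : blowupAlgebra I a = ⊥) :
    ∃ e : (R ⧸ RingHom.ker (algebraMap R (Localization.Away a))) ≃+* blowupAlgebra I a,
      ∀ r : R, e (Ideal.Quotient.mk _ r) = algebraMap R (blowupAlgebra I a) r := by
  let f : R →ₐ[R] blowupAlgebra I a := Algebra.ofId R _
  have hf : Function.Surjective f := by
    intro y
    have hy : (y : Localization.Away a) ∈ (⊥ : Subalgebra R (Localization.Away a)) := h ▸ y.2
    obtain ⟨r, hr⟩ := Algebra.mem_bot.mp hy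
    exact ⟨r, Subtype.ext hr⟩
  have hker : RingHom.ker (algebraMap R (Localization.Away a)) = RingHom.ker f := by
    ext r
    simp only [RingHom.mem_ker]
    constructor
    · intro hr; exact Subtype.ext hr
    · intro hr; exact congrArg Subtype.val hr
  let e₁ : (R ⧸ RingHom.ker f) ≃ₐ[R] blowupAlgebra I a := Ideal.quotientKerAlgEquivOfSurjective hf
  refine ⟨(Ideal.quotEquivOfEq hker).trans e₁.toRingEquiv, fun r => ?_⟩
  rw [RingEquiv.trans_apply, Ideal.quotEquivOfEq_mk]
  exact Ideal.quotientKerAlgEquivOfSurjective_mk hf r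

/-- If `R[I/a] = R · 1` then the chart ring `(R[It])_{(at)}` of `Bl_I(Spec R)` is `R` modulo the
`a`-power torsion (the kernel of `R → R[1/a]`), compatibly with the structure map. [folklore] -/
theorem exists_ringEquiv_away_of_blowupAlgebra_eq_bot {I : Ideal R} (a : R) (ha : a ∈ I)
    (h : blowupAlgebra I a = ⊥) :
    ∃ e : (R ⧸ RingHom.ker (algebraMap R (Localization.Away a))) ≃+*
        HomogeneousLocalization.Away (reesGrading I) (reesT a ha),
      ∀ r : R, e (Ideal.Quotient.mk _ r) = reesChartBase a ha r := by
  let f : R →ₐ[R] blowupAlgebra I a := Algebra.ofId R _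
  have hf : Function.Surjective f := by
    intro y
    have hy : (y : Localization.Away a) ∈ (⊥ : Subalgebra R (Localization.Away a)) := h ▸ y.2
    obtain ⟨r, hr⟩ := Algebra.mem_bot.mp hy
    exact ⟨r, Subtype.ext hr⟩
  have hker : RingHom.ker (algebraMap R (Localization.Away a)) = RingHom.ker f := by
    ext r
    simp only [RingHom.mem_ker]
    constructor
    · intro hr; exact Subtype.ext hr
    · intro hr; exact congrArg Subtype.val hr
  let e₁ : (R ⧸ RingHom.ker f) ≃ₐ[R] blowupAlgebra I a := Ideal.quotientKerAlgEquivOfSurjective hf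
  let e₂ : (R ⧸ RingHom.ker f) ≃+* HomogeneousLocalization.Away (reesGrading I) (reesT a ha) :=
    e₁.toRingEquiv.trans (reesChartEquiv a ha).symm
  refine ⟨(Ideal.quotEquivOfEq hker).trans e₂, fun r => ?_⟩
  rw [RingEquiv.trans_apply, Ideal.quotEquivOfEq_mk]
  change (reesChartEquiv a ha).symm (e₁ (Ideal.Quotient.mk _ r)) = _
  rw [Ideal.quotientKerAlgEquivOfSurjective_mk, RingEquiv.symm_apply_eq,
    reesChartEquiv_reesChartBase]
  rfl

/-- **Charts of generators with product zero are disjoint**: if `a b = 0` then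
`D₊(at) ∩ D₊(bt) = ∅` in `Bl_I(Spec R) = Proj R[It]` (`at · bt = (ab) t² = 0`). [folklore] -/
theorem basicOpen_inf_basicOpen_eq_bot_of_mul_eq_zero {I : Ideal R} {a b : R} (hab : a * b = 0)
    (ha : a ∈ I) (hb : b ∈ I) :
    AlgebraicGeometry.Proj.basicOpen (reesGrading I) (reesT a ha) ⊓
      AlgebraicGeometry.Proj.basicOpen (reesGrading I) (reesT b hb) = ⊥ := by
  rw [← AlgebraicGeometry.Proj.basicOpen_mul]
  have h0 : reesT (I := I) a ha * reesT b hb = 0 := by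
    apply Subtype.ext
    rw [Subalgebra.coe_mul, coe_reesT, coe_reesT, Polynomial.monomial_mul_monomial, hab, map_zero]
    rfl
  rw [h0, AlgebraicGeometry.Proj.basicOpen_zero]

/-- **The charts of two generators cover**: if `I = (a, b)` then `D₊(at) ∪ D₊(bt) = Bl_I(Spec R)`
(every `x = αa + βb ∈ I` has `xt = α·at + β·bt`, so `D₊(xt) ⊆ D₊(at) ∪ D₊(bt)`, and the `D₊(xt)`
cover, Stacks 0804). [cite: StacksProject, Tag 0804] -/
theorem basicOpen_sup_basicOpen_eq_top_of_span_pair {I : Ideal R} {a b : R}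
    (hI : I = Ideal.span {a, b}) (ha : a ∈ I) (hb : b ∈ I) :
    AlgebraicGeometry.Proj.basicOpen (reesGrading I) (reesT a ha) ⊔
      AlgebraicGeometry.Proj.basicOpen (reesGrading I) (reesT b hb) = ⊤ := by
  refine top_le_iff.mp ?_
  rw [← affineBlowup.iSup_basicOpen_reesT_eq_top I]
  refine iSup_le fun x => ?_
  obtain ⟨x, hx⟩ := x
  have hx' := hx
  rw [hI] at hx'
  obtain ⟨α, β, hαβ⟩ := Ideal.mem_span_pair.mp hx'
  have hdec : reesT (I := I) x hx =
      algebraMap _ (reesAlgebra I) α * reesT _ ha + algebraMap _ (reesAlgebra I) β * reesT _ hb := by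
    apply Subtype.ext
    simp only [coe_reesT, Subalgebra.coe_add, Subalgebra.coe_mul, Subalgebra.coe_algebraMap,
      Polynomial.algebraMap_eq, Polynomial.C_mul_monomial, ← hαβ, map_add]
  intro p hp
  rw [AlgebraicGeometry.Proj.mem_basicOpen] at hp
  rw [TopologicalSpace.Opens.mem_sup, AlgebraicGeometry.Proj.mem_basicOpen,
    AlgebraicGeometry.Proj.mem_basicOpen]
  by_contra hcon
  push Not at hcon
  apply hp
  rw [hdec]
  have h1 : algebraMap _ (reesAlgebra I) α * reesT _ ha ∈ p.asHomogeneousIdeal :=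
    Ideal.mul_mem_left _ _ hcon.1
  have h2 : algebraMap _ (reesAlgebra I) β * reesT _ hb ∈ p.asHomogeneousIdeal :=
    Ideal.mul_mem_left _ _ hcon.2
  exact Ideal.add_mem _ h1 h2

end BlowupGeneral

/-! ## The blow-up of `H = {στ = 0}` along `X = Σ ∪ R`: the two charts are the two sheets -/

section BlowupH

open Literature.AlgebraicGeometry.Resolution AlgebraicGeometry

variable {R : Type u} [CommRing R]

/-- The kernel of `S → S[1/a]` is the `a`-power torsion. [folklore] -/
theorem ker_algebraMap_away_eq {S : Type u} [CommRing S] (a : S) (J : Ideal S)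
    (hJ : ∀ x, x ∈ J ↔ ∃ n : ℕ, a ^ n * x = 0) :
    RingHom.ker (algebraMap S (Localization.Away a)) = J := by
  ext x
  rw [RingHom.mem_ker, IsLocalization.map_eq_zero_iff (Submonoid.powers a) (Localization.Away a), hJ]
  constructor
  · rintro ⟨⟨m, hm⟩, h⟩
    obtain ⟨n, rfl⟩ := (Submonoid.mem_powers_iff _ _).mp hm
    exact ⟨n, h⟩
  · rintro ⟨n, h⟩
    exact ⟨⟨a ^ n, Submonoid.pow_mem _ (Submonoid.mem_powers a) n⟩, h⟩

/-- The `σ̄`-power torsion of `𝒪_H = R[σ,τ,w]/(στ)` is `(τ̄)`, the ideal of the sheet `S₂ = {τ = 0}`.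
[folklore] -/
theorem mem_map_span_tau_iff
    (x : MvPolynomial (Fin 3) R ⧸ Ideal.span {(X 0 * X 1 : MvPolynomial (Fin 3) R)}) :
    x ∈ (Ideal.span {(X 1 : MvPolynomial (Fin 3) R)}).map
        (Ideal.Quotient.mk (Ideal.span {(X 0 * X 1 : MvPolynomial (Fin 3) R)})) ↔
      ∃ n : ℕ, (Ideal.Quotient.mk (Ideal.span {(X 0 * X 1 : MvPolynomial (Fin 3) R)}) (X 0)) ^ n * x = 0 := by
  obtain ⟨x, rfl⟩ := Ideal.Quotient.mk_surjective x
  rw [Ideal.map_span, Set.image_singleton]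
  constructor
  · intro hx
    obtain ⟨c, hc⟩ := Ideal.mem_span_singleton'.mp hx
    obtain ⟨c, rfl⟩ := Ideal.Quotient.mk_surjective c
    refine ⟨1, ?_⟩
    rw [pow_one, ← hc, ← map_mul, ← map_mul, Ideal.Quotient.eq_zero_iff_mem,
      show (X 0 * (c * X 1) : MvPolynomial (Fin 3) R) = c * (X 0 * X 1) by ring]
    exact Ideal.mul_mem_left _ _ (Ideal.mem_span_singleton_self _)
  · rintro ⟨n, hn⟩
    rw [← map_pow, ← map_mul, Ideal.Quotient.eq_zero_iff_mem] at hn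
    have hsub : Ideal.span {(X 0 * X 1 : MvPolynomial (Fin 3) R)} ≤ Ideal.span {(X 1 : MvPolynomial (Fin 3) R)} :=
      Ideal.span_singleton_le_span_singleton.mpr (dvd_mul_left _ _)
    have hx : X 0 ^ n * x ∈ Ideal.span ({X 1} : Set (MvPolynomial (Fin 3) R)) := hsub hn
    have hx' := mem_span_X_of_X_pow_mul_mem (R := R) (i := 1) (j := 0) (by decide) n hx
    obtain ⟨c, hc⟩ := Ideal.mem_span_singleton'.mp hx'
    exact Ideal.mem_span_singleton'.mpr ⟨Ideal.Quotient.mk _ c, by rw [← hc, map_mul]⟩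

/-- The `τ̄w̄`-power torsion of `𝒪_H` is `(σ̄)`, the ideal of the sheet `S₁ = {σ = 0}`. [folklore] -/
theorem mem_map_span_sigma_iff
    (x : MvPolynomial (Fin 3) R ⧸ Ideal.span {(X 0 * X 1 : MvPolynomial (Fin 3) R)}) :
    x ∈ (Ideal.span {(X 0 : MvPolynomial (Fin 3) R)}).map
        (Ideal.Quotient.mk (Ideal.span {(X 0 * X 1 : MvPolynomial (Fin 3) R)})) ↔
      ∃ n : ℕ, (Ideal.Quotient.mk (Ideal.span {(X 0 * X 1 : MvPolynomial (Fin 3) R)}) (X 1 * X 2)) ^ n * x = 0 := by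
  obtain ⟨x, rfl⟩ := Ideal.Quotient.mk_surjective x
  rw [Ideal.map_span, Set.image_singleton]
  constructor
  · intro hx
    obtain ⟨c, hc⟩ := Ideal.mem_span_singleton'.mp hx
    obtain ⟨c, rfl⟩ := Ideal.Quotient.mk_surjective c
    refine ⟨1, ?_⟩
    rw [pow_one, ← hc, ← map_mul, ← map_mul, Ideal.Quotient.eq_zero_iff_mem,
      show (X 1 * X 2 * (c * X 0) : MvPolynomial (Fin 3) R) = (c * X 2) * (X 0 * X 1) by ring]
    exact Ideal.mul_mem_left _ _ (Ideal.mem_span_singleton_self _)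
  · rintro ⟨n, hn⟩
    rw [← map_pow, ← map_mul, Ideal.Quotient.eq_zero_iff_mem] at hn
    have hsub : Ideal.span {(X 0 * X 1 : MvPolynomial (Fin 3) R)} ≤ Ideal.span {(X 0 : MvPolynomial (Fin 3) R)} :=
      Ideal.span_singleton_le_span_singleton.mpr (dvd_mul_right _ _)
    have hx : X 1 ^ n * (X 2 ^ n * x) ∈ Ideal.span ({X 0} : Set (MvPolynomial (Fin 3) R)) := by
      have e : ((X 1 * X 2) ^ n * x : MvPolynomial (Fin 3) R) = X 1 ^ n * (X 2 ^ n * x) := by ring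
      rw [← e]
      exact hsub hn
    have hx' := mem_span_X_of_X_pow_mul_mem (R := R) (i := 0) (j := 2) (by decide) n
      (mem_span_X_of_X_pow_mul_mem (R := R) (i := 0) (j := 1) (by decide) n hx)
    obtain ⟨c, hc⟩ := Ideal.mem_span_singleton'.mp hx'
    exact Ideal.mem_span_singleton'.mpr ⟨Ideal.Quotient.mk _ c, by rw [← hc, map_mul]⟩

/-- **Chart `D₊(σ̄ t)` of `Bl_X H` is the sheet `S₂ = {τ = 0}`**: for `𝒪_H = R[σ,τ,w]/(στ)` and the
trace ideal `I = (σ̄, τ̄w̄)` of `X = Σ ∪ R`, the chart ring `(𝒪_H[It])_{(σ̄t)} = 𝒪_H[I/σ̄]` is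
`R[σ,τ,w]/(τ)`, compatibly with `𝒪_H → R[σ,τ,w]/(τ)` (so `Bl_X` restricted over this chart is the
closed immersion of the sheet `S₂`, an isomorphism `Bl_X S₂ ≅ S₂`). [folklore] -/
theorem junction_transversal_chart_sigma
    (I : Ideal (MvPolynomial (Fin 3) R ⧸ Ideal.span {(X 0 * X 1 : MvPolynomial (Fin 3) R)}))
    (hI : I = Ideal.span {Ideal.Quotient.mk _ (X 0), Ideal.Quotient.mk _ (X 1 * X 2)}) :
    ∃ e : blowupAlgebra I (Ideal.Quotient.mk (Ideal.span {(X 0 * X 1 : MvPolynomial (Fin 3) R)}) (X 0)) ≃+*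
        (MvPolynomial (Fin 3) R ⧸ Ideal.span {(X 1 : MvPolynomial (Fin 3) R)}),
      ∀ x : MvPolynomial (Fin 3) R,
        e (algebraMap (MvPolynomial (Fin 3) R ⧸ Ideal.span {(X 0 * X 1 : MvPolynomial (Fin 3) R)}) _
          (Ideal.Quotient.mk (Ideal.span {(X 0 * X 1 : MvPolynomial (Fin 3) R)}) x)) =
        Ideal.Quotient.mk (Ideal.span {(X 1 : MvPolynomial (Fin 3) R)}) x := by
  have hab : Ideal.Quotient.mk (Ideal.span {(X 0 * X 1 : MvPolynomial (Fin 3) R)}) (X 0) *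
      Ideal.Quotient.mk (Ideal.span {(X 0 * X 1 : MvPolynomial (Fin 3) R)}) (X 1 * X 2) = 0 := by
    rw [← map_mul, Ideal.Quotient.eq_zero_iff_mem, ← mul_assoc]
    exact Ideal.mul_mem_right _ _ (Ideal.mem_span_singleton_self _)
  obtain ⟨e₁, he₁⟩ := exists_ringEquiv_blowupAlgebra_of_eq_bot _
    (blowupAlgebra_eq_bot_of_mul_eq_zero hab hI)
  have hker := ker_algebraMap_away_eq _ _ (mem_map_span_tau_iff (R := R))
  have hsup : Ideal.span {(X 0 * X 1 : MvPolynomial (Fin 3) R)} ⊔ Ideal.span {X 1} =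
      Ideal.span {X 1} :=
    sup_eq_right.mpr (Ideal.span_singleton_le_span_singleton.mpr (dvd_mul_left _ _))
  let e₂ := (Ideal.quotEquivOfEq hker).trans
    ((DoubleQuot.quotQuotEquivQuotSup (Ideal.span {(X 0 * X 1 : MvPolynomial (Fin 3) R)})
      (Ideal.span {(X 1 : MvPolynomial (Fin 3) R)})).trans (Ideal.quotEquivOfEq hsup))
  refine ⟨e₁.symm.trans e₂, fun x => ?_⟩
  rw [RingEquiv.trans_apply, ← he₁, RingEquiv.symm_apply_apply]
  change Ideal.quotEquivOfEq hsup (DoubleQuot.quotQuotEquivQuotSup _ _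
    (Ideal.quotEquivOfEq hker (Ideal.Quotient.mk _ (Ideal.Quotient.mk _ x)))) = _
  rw [Ideal.quotEquivOfEq_mk]
  have h2 : DoubleQuot.quotQuotEquivQuotSup (Ideal.span {(X 0 * X 1 : MvPolynomial (Fin 3) R)})
      (Ideal.span {(X 1 : MvPolynomial (Fin 3) R)}) (Ideal.Quotient.mk _ (Ideal.Quotient.mk _ x)) =
      Ideal.Quotient.mk _ x :=
    DoubleQuot.quotQuotEquivQuotSup_quotQuotMk _ _ x
  rw [h2, Ideal.quotEquivOfEq_mk]

/-- **Chart `D₊(τ̄w̄ t)` of `Bl_X H` is the sheet `S₁ = {σ = 0}`**: the chart ring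
`(𝒪_H[It])_{(τ̄w̄t)} = 𝒪_H[I/τ̄w̄]` is `R[σ,τ,w]/(σ)`, compatibly with the structure maps
(`Bl_X S₁ ≅ S₁`: the trace `(τw)` is principal on `S₁`). [folklore] -/
theorem junction_transversal_chart_tauw
    (I : Ideal (MvPolynomial (Fin 3) R ⧸ Ideal.span {(X 0 * X 1 : MvPolynomial (Fin 3) R)}))
    (hI : I = Ideal.span {Ideal.Quotient.mk _ (X 0), Ideal.Quotient.mk _ (X 1 * X 2)}) :
    ∃ e : blowupAlgebra I (Ideal.Quotient.mk (Ideal.span {(X 0 * X 1 : MvPolynomial (Fin 3) R)}) (X 1 * X 2)) ≃+*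
        (MvPolynomial (Fin 3) R ⧸ Ideal.span {(X 0 : MvPolynomial (Fin 3) R)}),
      ∀ x : MvPolynomial (Fin 3) R,
        e (algebraMap (MvPolynomial (Fin 3) R ⧸ Ideal.span {(X 0 * X 1 : MvPolynomial (Fin 3) R)}) _
          (Ideal.Quotient.mk (Ideal.span {(X 0 * X 1 : MvPolynomial (Fin 3) R)}) x)) =
        Ideal.Quotient.mk (Ideal.span {(X 0 : MvPolynomial (Fin 3) R)}) x := by
  have hba : Ideal.Quotient.mk (Ideal.span {(X 0 * X 1 : MvPolynomial (Fin 3) R)}) (X 1 * X 2) *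
      Ideal.Quotient.mk (Ideal.span {(X 0 * X 1 : MvPolynomial (Fin 3) R)}) (X 0) = 0 := by
    rw [← map_mul, Ideal.Quotient.eq_zero_iff_mem,
      show (X 1 * X 2 * X 0 : MvPolynomial (Fin 3) R) = X 2 * (X 0 * X 1) by ring]
    exact Ideal.mul_mem_left _ _ (Ideal.mem_span_singleton_self _)
  have hI' : I = Ideal.span {Ideal.Quotient.mk _ (X 1 * X 2), Ideal.Quotient.mk _ (X 0)} := by
    rw [hI, Ideal.span_pair_comm]
  obtain ⟨e₁, he₁⟩ := exists_ringEquiv_blowupAlgebra_of_eq_bot _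
    (blowupAlgebra_eq_bot_of_mul_eq_zero hba hI')
  have hker := ker_algebraMap_away_eq _ _ (mem_map_span_sigma_iff (R := R))
  have hsup : Ideal.span {(X 0 * X 1 : MvPolynomial (Fin 3) R)} ⊔ Ideal.span {X 0} =
      Ideal.span {X 0} :=
    sup_eq_right.mpr (Ideal.span_singleton_le_span_singleton.mpr (dvd_mul_right _ _))
  let e₂ := (Ideal.quotEquivOfEq hker).trans
    ((DoubleQuot.quotQuotEquivQuotSup (Ideal.span {(X 0 * X 1 : MvPolynomial (Fin 3) R)})
      (Ideal.span {(X 0 : MvPolynomial (Fin 3) R)})).trans (Ideal.quotEquivOfEq hsup))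
  refine ⟨e₁.symm.trans e₂, fun x => ?_⟩
  rw [RingEquiv.trans_apply, ← he₁, RingEquiv.symm_apply_apply]
  change Ideal.quotEquivOfEq hsup (DoubleQuot.quotQuotEquivQuotSup _ _
    (Ideal.quotEquivOfEq hker (Ideal.Quotient.mk _ (Ideal.Quotient.mk _ x)))) = _
  rw [Ideal.quotEquivOfEq_mk]
  have h2 : DoubleQuot.quotQuotEquivQuotSup (Ideal.span {(X 0 * X 1 : MvPolynomial (Fin 3) R)})
      (Ideal.span {(X 0 : MvPolynomial (Fin 3) R)}) (Ideal.Quotient.mk _ (Ideal.Quotient.mk _ x)) =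
      Ideal.Quotient.mk _ x :=
    DoubleQuot.quotQuotEquivQuotSup_quotQuotMk _ _ x
  rw [h2, Ideal.quotEquivOfEq_mk]

/-- **The two charts are disjoint** (`σ̄ t · τ̄w̄ t = (στw)‾ t² = 0` in the Rees algebra of
`𝒪_H`): `Bl_X` SEPARATES the sheets — the strict transforms `St S₁ ⊆ D₊(τ̄w̄t)` and
`St S₂ ⊆ D₊(σ̄t)` do not meet. [folklore] -/
theorem junction_transversal_charts_disjoint
    (I : Ideal (MvPolynomial (Fin 3) R ⧸ Ideal.span {(X 0 * X 1 : MvPolynomial (Fin 3) R)}))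
    (ha : Ideal.Quotient.mk (Ideal.span {(X 0 * X 1 : MvPolynomial (Fin 3) R)}) (X 0) ∈ I)
    (hb : Ideal.Quotient.mk (Ideal.span {(X 0 * X 1 : MvPolynomial (Fin 3) R)}) (X 1 * X 2) ∈ I) :
    Proj.basicOpen (reesGrading I) (reesT _ ha) ⊓ Proj.basicOpen (reesGrading I) (reesT _ hb) = ⊥ := by
  refine basicOpen_inf_basicOpen_eq_bot_of_mul_eq_zero ?_ ha hb
  rw [← map_mul, Ideal.Quotient.eq_zero_iff_mem, ← mul_assoc]
  exact Ideal.mul_mem_right _ _ (Ideal.mem_span_singleton_self _)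

/-- **The two charts cover `Bl_X H`**. Together with the two chart computations and their
disjointness: **`Bl_X H = S₂ ⊔ S₁` is the normalisation of `H`**, `Bl_X` is an isomorphism on each
sheet and separates them — no damage (`Bl_X H ≅ H^ν = Bl_Σ H`). [folklore] -/
theorem junction_transversal_charts_cover
    (I : Ideal (MvPolynomial (Fin 3) R ⧸ Ideal.span {(X 0 * X 1 : MvPolynomial (Fin 3) R)}))
    (hI : I = Ideal.span {Ideal.Quotient.mk _ (X 0), Ideal.Quotient.mk _ (X 1 * X 2)})
    (ha : Ideal.Quotient.mk (Ideal.span {(X 0 * X 1 : MvPolynomial (Fin 3) R)}) (X 0) ∈ I)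
    (hb : Ideal.Quotient.mk (Ideal.span {(X 0 * X 1 : MvPolynomial (Fin 3) R)}) (X 1 * X 2) ∈ I) :
    Proj.basicOpen (reesGrading I) (reesT _ ha) ⊔ Proj.basicOpen (reesGrading I) (reesT _ hb) = ⊤ :=
  basicOpen_sup_basicOpen_eq_top_of_span_pair hI ha hb

end BlowupH
end Summit.ResolutionOfSingularities.ResolutionOfSingularities.Theorems.EquisingularLift.Junction

end
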